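import Summits.QuantumFields.BalabanUV.Beta.GAN24.E3UnitSplitSum
import Literature.MathematicalPhysics.QuantumFieldTheory.Balaban1983to89.Beta.DecLiftAdjoint
import Literature.MathematicalPhysics.QuantumFieldTheory.Balaban1983to89.Beta.AveragingHessianKernelsRooted

/-!
# `BalabanUV.Beta.GAN24.E3UnitSplitLevelsVSymAt` — binder row G-an2-4 / (CONV-C), road S3 AT THE IN-BLOCK ROOT, V half, THE SYMMETRIC COMB TABLE (OWNER gan24-p1-g21 (W15)):
# **THE THREE (V-H) UNIT TEMPLATES FOR THE UN-NEGATED ROOTED TABLE `vhSAt ρ` AND ITS `M`-CONTOUR SUM `DecLiftAdjoint.borderSum M (fun κ z ↦ vhSAt ρ d Lc rfl κ z)`** (any root `ρ`;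
# leaf-01's generic `e3VH_unit_split_of` BY NAME — only the off-diagonality of the pieces is re-checked, by an1's `packVH` (`rfl`)).  The `mfNeg` ∕ `borderIncAt` twin is MY
# `E3UnitSplitLevelsVAt` (p297680).

NOT IN PRINT; OUR BOOKKEEPING (unit `b2b-balaban-gan24-p2`, gen 33 = prover-b2b-balaban-gan24-p2-g33-0, road-P2 chair of row G-an2-4; CRUX TEAM (2), 2026-08-21; mkroot METHOD; base modules
untouched).  [folklore]; 0 `def`, 0 cited facts, 0 `def … : Prop`, 0 sorry; NO estimate of Bałaban's.  HONEST FRAMING (cell contract, verbatim): «discharging `BetaPertH` makes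
Bałaban's UV stability UNCONDITIONAL — a real constructive-QFT result; it is NOT the continuum limit and NOT the Clay problem.»  HONEST DEPENDENCY (verbatim): «continuum YM on T⁴ ⇐
BetaPertH ∧ nine spine estimates (0/9 proved); BetaPertH ⇐ (D1) ∧ (D4) ∧ CAP+tail; G-an2-4 gates asym, D1 and NE2/3/4.»

## What (generic `d`; ANY root `ρ`)
* §1 blocks: `vhSAt_ff ∕ vhSAt_mm` (`rfl`), `borderSumV_inl_inl ∕ _inr_inr`, `pushSum_vhSAt_inl_inl ∕ _inr_inr`, `pushSum_borderSumV_inl_inl ∕ _inr_inr`.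
* §2 templates: **`e3VH_unit_split_at`** (`P = pushSum (Lc^(ℓ+1)) (Lc^k) (borderSum (Lc^ℓ) (vhSAt ρ …) κ u)`), **`e3VHTop_unit_split_at`** (`k = 0`), **`e3VH0_unit_split_at`**
  (`P = pushSum Lc (Lc^k) (vhSAt ρ d Lc κ u)`) — the base templates symbol for symbol with the SYMMETRIC rooted pieces (no `mfNeg`).
USE: `TaylorRowVSymAt`, `S3ShapeVtSymAt`, `S3RowV0SymAt`.  Discharges NOTHING of (hS, hSall) ∕ hB; NEVER «G-an2-4 closed»; NOT D1, NOT BetaPertH, NOT continuum, NOT Clay.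
-/

noncomputable section

open Finset
open scoped BigOperators
open Literature.MathematicalPhysics.QuantumFieldTheory
open Literature.MathematicalPhysics.QuantumFieldTheory.Balaban1983to89
open Literature.MathematicalPhysics.QuantumFieldTheory.Balaban1983to89.Beta
open ExpKernelCalculus (MKer)
open KernelSpecInstance (wH wΦ)
open KKTFluctuationKernel (GamΦ)
open OneStepResolventKernel (Fib KInv)
open InterLevelTransport (avgLift)
open AveragingHessianKernels (vhS packVH_inl_inl packVH_inr_inr)
open AveragingHessianKernelsRooted (vhSAt)
open BalabanCompositeJets (pushSum pushSum_inl_inl borderInc)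
open DecLiftAdjoint (borderSum)
open Summit.QuantumFields.BalabanUV.Beta.GAN24.E3UnitSplit (e3OfS pushSum_block_zero avgLift_block_zero e3VH_unit_split_of)

namespace Summit.QuantumFields.BalabanUV.Beta.GAN24.E3UnitSplitLevelsVSymAt

variable {d : ℕ}

/-! ## §1 The rooted (V-H) pieces are off-diagonal -/

section Blocks

variable {Lc : ℕ}

/-- [folklore] The rooted (V-H) table has no field–field block (an1's `packVH`, any root; `StencilSlotVHRoot.vhSAt_inl_inl` restated to keep imports light). -/
theorem vhSAt_ff (ρ : Fin (d + 1) → ℤ) (κ : Fin (d + 1)) (u x z : Fin (d + 1) → ℤ) (α β : Fin (d + 1)) :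
    vhSAt ρ d Lc rfl κ u x z (Sum.inl α) (Sum.inl β) = 0 := rfl

/-- [folklore] … and no multiplier–multiplier block. -/
theorem vhSAt_mm (ρ : Fin (d + 1) → ℤ) (κ : Fin (d + 1)) (u x z : Fin (d + 1) → ℤ) (μ ν : Fin (d + 1)) :
    vhSAt ρ d Lc rfl κ u x z (Sum.inr μ) (Sum.inr ν) = 0 := rfl

/-- [folklore] **THE ROOTED BORDER INCREMENT IS OFF-DIAGONAL**: no field–field block … -/
theorem borderSumV_inl_inl (ρ : Fin (d + 1) → ℤ) {M : ℕ} (κ : Fin (d + 1)) (u x z : Fin (d + 1) → ℤ) (α β : Fin (d + 1)) :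
    borderSum M (fun κ₀ z₀ => vhSAt ρ d Lc rfl κ₀ z₀) κ u x z (Sum.inl α) (Sum.inl β) = 0 := by
  simp only [borderSum]
  exact Finset.sum_eq_zero fun s _ => avgLift_block_zero _ _ _ (fun x z => vhSAt_ff ρ κ _ x z α β) x z

/-- [folklore] … and no multiplier–multiplier block. -/
theorem borderSumV_inr_inr (ρ : Fin (d + 1) → ℤ) {M : ℕ} (κ : Fin (d + 1)) (u x z : Fin (d + 1) → ℤ) (μ ν : Fin (d + 1)) :
    borderSum M (fun κ₀ z₀ => vhSAt ρ d Lc rfl κ₀ z₀) κ u x z (Sum.inr μ) (Sum.inr ν) = 0 := by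
  simp only [borderSum]
  exact Finset.sum_eq_zero fun s _ => avgLift_block_zero _ _ _ (fun x z => vhSAt_mm ρ κ _ x z μ ν) x z

/-- [folklore] A pushed rooted `S₀` (V-H) stencil is off-diagonal (ff). -/
theorem pushSum_vhSAt_ff (ρ : Fin (d + 1) → ℤ) {M L : ℕ} (κ : Fin (d + 1)) (u x z : Fin (d + 1) → ℤ) (α β : Fin (d + 1)) :
    pushSum M L (vhSAt ρ d Lc rfl κ u) x z (Sum.inl α) (Sum.inl β) = 0 := by
  rw [pushSum_inl_inl, vhSAt_ff]

/-- [folklore] A pushed rooted `S₀` (V-H) stencil is off-diagonal (mm). -/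
theorem pushSum_vhSAt_mm (ρ : Fin (d + 1) → ℤ) {M L : ℕ} (κ : Fin (d + 1)) (u x z : Fin (d + 1) → ℤ) (μ ν : Fin (d + 1)) :
    pushSum M L (vhSAt ρ d Lc rfl κ u) x z (Sum.inr μ) (Sum.inr ν) = 0 :=
  pushSum_block_zero _ _ _ (fun x z => vhSAt_mm ρ κ u x z μ ν) x z

/-- [folklore] A pushed rooted border increment is off-diagonal (ff). -/
theorem pushSum_borderSumV_inl_inl (ρ : Fin (d + 1) → ℤ) {M L M' : ℕ} (κ : Fin (d + 1)) (u x z : Fin (d + 1) → ℤ) (α β : Fin (d + 1)) :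
    pushSum M L (borderSum M' (fun κ₀ z₀ => vhSAt ρ d Lc rfl κ₀ z₀) κ u) x z (Sum.inl α) (Sum.inl β) = 0 := by
  rw [pushSum_inl_inl, borderSumV_inl_inl]

/-- [folklore] A pushed rooted border increment is off-diagonal (mm). -/
theorem pushSum_borderSumV_inr_inr (ρ : Fin (d + 1) → ℤ) {M L M' : ℕ} (κ : Fin (d + 1)) (u x z : Fin (d + 1) → ℤ) (μ ν : Fin (d + 1)) :
    pushSum M L (borderSum M' (fun κ₀ z₀ => vhSAt ρ d Lc rfl κ₀ z₀) κ u) x z (Sum.inr μ) (Sum.inr ν) = 0 :=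
  pushSum_block_zero _ _ _ (fun x z => borderSumV_inr_inr ρ κ u x z μ ν) x z

end Blocks

/-! ## §2 The three rooted (V-H) templates -/

section Levels

variable {Lc : ℕ} [NeZero Lc]

/-- [folklore] **THE ROOTED (V-H) TEMPLATE, LEVEL `ℓ ≥ 1`, PUSHED `k` TIMES** (any root `ρ`): `P = pushSum (Lc^{ℓ+1}) (Lc^k) (borderSum (Lc^ℓ) (vhSAt ρ …) κ u)` (SYMMETRIC table) in leaf-01's
`e3VH_unit_split_of` — the base `e3VH_unit_split` symbol for symbol with the rooted increment. -/
theorem e3VH_unit_split_at (ρ : Fin (d + 1) → ℤ) (cVH : ℝ) (ℓ k p : ℕ) (hp : p = ℓ + k + 1) (κ' : Fin (d + 1)) (u' x' z' : Fin (d + 1) → ℤ) (α β : Fin (d + 1)) :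
    ((Lc : ℝ) ^ p) ^ (2 * (d + 1)) *
        e3OfS (Lc ^ p) (fun κ u => (((Lc : ℝ) ^ (d + 1)) ^ k * (cVH * ((Lc : ℝ) ^ ℓ) ^ (d + 2))) • pushSum (Lc ^ (ℓ + 1)) (Lc ^ k) (borderSum (Lc ^ ℓ) (fun κ₀ z₀ => vhSAt ρ d Lc rfl κ₀ z₀) κ u)) κ' u' x' z' (Sum.inl α) (Sum.inl β) =
      -(cVH / (Lc : ℝ) ^ (d + 1)) * ((Lc : ℝ) ^ p) ^ (-(2 : ℤ)) * (Lc : ℝ) ^ ℓ *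
        ∑' y : Fin (d + 1) → ℤ,
          ((∑ l' : Fin (d + 1),
            (∑' w : Fin (d + 1) → ℤ, ∑ l : Fin (d + 1),
                (((Lc : ℝ) ^ p) ^ (2 * (d + 1)) * KInv (N := Lc ^ p) (d := d) (((Lc ^ p : ℕ) : ℤ) • x') w (Sum.inr α) (Sum.inr l)) *
                ∑ κ'' : Fin (d + 1), (((Lc : ℝ) ^ p) ^ (d + 1))⁻¹ * ∑' u : Fin (d + 1) → ℤ,
                  (((Lc : ℝ) ^ p) ^ (d + 2) * wH (N := Lc ^ p) κ'' κ' (u - ((Lc ^ p : ℕ) : ℤ) • u')) *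
                    pushSum (Lc ^ (ℓ + 1)) (Lc ^ k) (borderSum (Lc ^ ℓ) (fun κ₀ z₀ => vhSAt ρ d Lc rfl κ₀ z₀) κ'' u) w y (Sum.inr l) (Sum.inl l')) *
              (((Lc : ℝ) ^ p) ^ (d + 2) * wH (N := Lc ^ p) l' β (y - ((Lc ^ p : ℕ) : ℤ) • z'))) +
          ∑ l' : Fin (d + 1),
            (∑' w : Fin (d + 1) → ℤ, ∑ l : Fin (d + 1),
                (((Lc : ℝ) ^ p) ^ (d + 2) * GamΦ (N := Lc ^ p) α x' l w) *
                ∑ κ'' : Fin (d + 1), (((Lc : ℝ) ^ p) ^ (d + 1))⁻¹ * ∑' u : Fin (d + 1) → ℤ,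
                  (((Lc : ℝ) ^ p) ^ (d + 2) * wH (N := Lc ^ p) κ'' κ' (u - ((Lc ^ p : ℕ) : ℤ) • u')) *
                    pushSum (Lc ^ (ℓ + 1)) (Lc ^ k) (borderSum (Lc ^ ℓ) (fun κ₀ z₀ => vhSAt ρ d Lc rfl κ₀ z₀) κ'' u) w y (Sum.inl l) (Sum.inr l')) *
              (((Lc : ℝ) ^ p) ^ (2 * (d + 1)) *
                KInv (N := Lc ^ p) (d := d) y (((Lc ^ p : ℕ) : ℤ) • z') (Sum.inr l') (Sum.inr β))) :=
  e3VH_unit_split_of (Lc := Lc) (fun κ u => pushSum (Lc ^ (ℓ + 1)) (Lc ^ k) (borderSum (Lc ^ ℓ) (fun κ₀ z₀ => vhSAt ρ d Lc rfl κ₀ z₀) κ u))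
    (fun κ u x z α β => pushSum_borderSumV_inl_inl ρ κ u x z α β) (fun κ u x z μ ν => pushSum_borderSumV_inr_inr ρ κ u x z μ ν)
    cVH ℓ k p hp κ' u' x' z' α β

/-- [folklore] **THE ROOTED (V-H) TEMPLATE, TOP LEVEL** (`k = 0`: the unpushed rooted top border increment, natural weight `cVH·M^{d+2}`, member `p = ℓ+1`). -/
theorem e3VHTop_unit_split_at (ρ : Fin (d + 1) → ℤ) (cVH : ℝ) (ℓ p : ℕ) (hp : p = ℓ + 1) (κ' : Fin (d + 1)) (u' x' z' : Fin (d + 1) → ℤ) (α β : Fin (d + 1)) :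
    ((Lc : ℝ) ^ p) ^ (2 * (d + 1)) *
        e3OfS (Lc ^ p) (fun κ u => (cVH * ((Lc : ℝ) ^ ℓ) ^ (d + 2)) • borderSum (Lc ^ ℓ) (fun κ₀ z₀ => vhSAt ρ d Lc rfl κ₀ z₀) κ u) κ' u' x' z' (Sum.inl α) (Sum.inl β) =
      -(cVH / (Lc : ℝ) ^ (d + 1)) * ((Lc : ℝ) ^ p) ^ (-(2 : ℤ)) * (Lc : ℝ) ^ ℓ *
        ∑' y : Fin (d + 1) → ℤ,
          ((∑ l' : Fin (d + 1),
            (∑' w : Fin (d + 1) → ℤ, ∑ l : Fin (d + 1),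
                (((Lc : ℝ) ^ p) ^ (2 * (d + 1)) * KInv (N := Lc ^ p) (d := d) (((Lc ^ p : ℕ) : ℤ) • x') w (Sum.inr α) (Sum.inr l)) *
                ∑ κ'' : Fin (d + 1), (((Lc : ℝ) ^ p) ^ (d + 1))⁻¹ * ∑' u : Fin (d + 1) → ℤ,
                  (((Lc : ℝ) ^ p) ^ (d + 2) * wH (N := Lc ^ p) κ'' κ' (u - ((Lc ^ p : ℕ) : ℤ) • u')) *
                    borderSum (Lc ^ ℓ) (fun κ₀ z₀ => vhSAt ρ d Lc rfl κ₀ z₀) κ'' u w y (Sum.inr l) (Sum.inl l')) *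
              (((Lc : ℝ) ^ p) ^ (d + 2) * wH (N := Lc ^ p) l' β (y - ((Lc ^ p : ℕ) : ℤ) • z'))) +
          ∑ l' : Fin (d + 1),
            (∑' w : Fin (d + 1) → ℤ, ∑ l : Fin (d + 1),
                (((Lc : ℝ) ^ p) ^ (d + 2) * GamΦ (N := Lc ^ p) α x' l w) *
                ∑ κ'' : Fin (d + 1), (((Lc : ℝ) ^ p) ^ (d + 1))⁻¹ * ∑' u : Fin (d + 1) → ℤ,
                  (((Lc : ℝ) ^ p) ^ (d + 2) * wH (N := Lc ^ p) κ'' κ' (u - ((Lc ^ p : ℕ) : ℤ) • u')) *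
                    borderSum (Lc ^ ℓ) (fun κ₀ z₀ => vhSAt ρ d Lc rfl κ₀ z₀) κ'' u w y (Sum.inl l) (Sum.inr l')) *
              (((Lc : ℝ) ^ p) ^ (2 * (d + 1)) *
                KInv (N := Lc ^ p) (d := d) y (((Lc ^ p : ℕ) : ℤ) • z') (Sum.inr l') (Sum.inr β))) := by
  simpa only [pow_zero, one_mul] using
    e3VH_unit_split_of (Lc := Lc) (fun κ u => borderSum (Lc ^ ℓ) (fun κ₀ z₀ => vhSAt ρ d Lc rfl κ₀ z₀) κ u) (fun κ u x z α β => borderSumV_inl_inl ρ κ u x z α β)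
      (fun κ u x z μ ν => borderSumV_inr_inr ρ κ u x z μ ν) cVH ℓ 0 p (by simpa using hp) κ' u' x' z' α β

/-- [folklore] **THE ROOTED (V-H) TEMPLATE, LEVEL `0`, PUSHED `k` TIMES** (`S₀`'s rooted (V-H) stencil, natural weight `(Lc^{d+1})^k·cVH`, member `p = k+1`; `M = 1`):
`P = pushSum Lc (Lc^k) (vhSAt ρ d Lc κ u)` — the base `E3UnitSplitSum.e3VH0_unit_split` symbol for symbol with an1's UN-NEGATED rooted table. -/
theorem e3VH0_unit_split_at (ρ : Fin (d + 1) → ℤ) (cVH : ℝ) (k p : ℕ) (hp : p = k + 1) (κ' : Fin (d + 1)) (u' x' z' : Fin (d + 1) → ℤ) (α β : Fin (d + 1)) :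
    ((Lc : ℝ) ^ p) ^ (2 * (d + 1)) *
        e3OfS (Lc ^ p) (fun κ u => (((Lc : ℝ) ^ (d + 1)) ^ k * cVH) • pushSum Lc (Lc ^ k) (vhSAt ρ d Lc rfl κ u)) κ' u' x' z' (Sum.inl α) (Sum.inl β) =
      -(cVH / (Lc : ℝ) ^ (d + 1)) * ((Lc : ℝ) ^ p) ^ (-(2 : ℤ)) *
        ∑' y : Fin (d + 1) → ℤ,
          ((∑ l' : Fin (d + 1),
            (∑' w : Fin (d + 1) → ℤ, ∑ l : Fin (d + 1),
                (((Lc : ℝ) ^ p) ^ (2 * (d + 1)) * KInv (N := Lc ^ p) (d := d) (((Lc ^ p : ℕ) : ℤ) • x') w (Sum.inr α) (Sum.inr l)) *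
                ∑ κ'' : Fin (d + 1), (((Lc : ℝ) ^ p) ^ (d + 1))⁻¹ * ∑' u : Fin (d + 1) → ℤ,
                  (((Lc : ℝ) ^ p) ^ (d + 2) * wH (N := Lc ^ p) κ'' κ' (u - ((Lc ^ p : ℕ) : ℤ) • u')) *
                    pushSum Lc (Lc ^ k) (vhSAt ρ d Lc rfl κ'' u) w y (Sum.inr l) (Sum.inl l')) *
              (((Lc : ℝ) ^ p) ^ (d + 2) * wH (N := Lc ^ p) l' β (y - ((Lc ^ p : ℕ) : ℤ) • z'))) +
          ∑ l' : Fin (d + 1),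
            (∑' w : Fin (d + 1) → ℤ, ∑ l : Fin (d + 1),
                (((Lc : ℝ) ^ p) ^ (d + 2) * GamΦ (N := Lc ^ p) α x' l w) *
                ∑ κ'' : Fin (d + 1), (((Lc : ℝ) ^ p) ^ (d + 1))⁻¹ * ∑' u : Fin (d + 1) → ℤ,
                  (((Lc : ℝ) ^ p) ^ (d + 2) * wH (N := Lc ^ p) κ'' κ' (u - ((Lc ^ p : ℕ) : ℤ) • u')) *
                    pushSum Lc (Lc ^ k) (vhSAt ρ d Lc rfl κ'' u) w y (Sum.inl l) (Sum.inr l')) *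
              (((Lc : ℝ) ^ p) ^ (2 * (d + 1)) *
                KInv (N := Lc ^ p) (d := d) y (((Lc ^ p : ℕ) : ℤ) • z') (Sum.inr l') (Sum.inr β))) := by
  simpa only [pow_zero, one_pow, mul_one] using
    e3VH_unit_split_of (Lc := Lc) (fun κ u => pushSum Lc (Lc ^ k) (vhSAt ρ d Lc rfl κ u))
      (fun κ u x z α β => pushSum_vhSAt_ff ρ κ u x z α β) (fun κ u x z μ ν => pushSum_vhSAt_mm ρ κ u x z μ ν) cVH 0 k p (by simpa using hp)
      κ' u' x' z' α β

end Levels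

end Summit.QuantumFields.BalabanUV.Beta.GAN24.E3UnitSplitLevelsVSymAt

end
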